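import Mathlib
import Literature.Computability.AlgebraicComplexity.FixedPointLog
import HarnessLib

/-!
# Kernel LOWER bounds of the far (prime-shift) constant of the Weil window ladder — the floor from below

Helper file (`--supports stmt-RiemannHypothesis-0098`, lead-track anchor: Weil-positivity window ladder, format-C far bound),
RH-free, pure proofs.  Seat rh-explicit-weil-1 gen8 (memo `run/shared/lean/pub/rh-explicit/rh-explicit-weil-1/FORMAT-K3.md` §9).

Every format-C door of the ladder consumes a FAR constant `A` of its window `[−a, a]`:
`Σ_{n < N} 2Λ(n)/√n ∫ f(x − log n) f(x) dx ≤ A · ∫ f²` for all real measurable bounded `f` vanishing off `[−a, a]`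
(`e^{2a} ≤ N`; route K3 / KCell certifies such `A` — `shiftBound_range…`, `jointShiftBound_…_cells…` — and
`farCoercivityFloor_le_of_shiftBound` (`WeilFarCoercivityFloor`) turns each into an UPPER bound of the floor `λ_max(a)`).
This file proves the converse direction in the kernel: testing the hypothesis on the explicit two-step even function
`f = h·1_[−a,−a+d] + 1_[−a+d, a−d] + h·1_[a−d, a]` gives `L ≤ A` for an explicit rational `L`, so every landed far
constant is BRACKETED, `L ≤ λ_max(a) ≤ A`.  Ingredients: the autocorrelation of a step function is a finite sum of overlap
lengths `max (min (βᵢ+u) βⱼ − max (αᵢ+u) αⱼ) 0` (`integral_stepTest_shift_mul`), monotone in a bracket of `u = log n`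
(`stepOverlap_mono`), plus certified logarithm brackets from the tree's fixed-point logarithm (`FixedPoint.logNatLo/Hi`,
`decide +kernel`).  Numbers (this file's L ≤ floor λ_max (Galerkin float, memo §8.6) ≤ the landed / staged constant):
a = 1: 1838/1000 ≤ 1.946 ≤ `primeCoeff_form_ge_cells_one_v2` 2027/1000 (p334036) · a = 1198/1000: 2649/1000 ≤ 2.695 ≤ `primeCoeff_form_ge_cells_1198` 2773/1000 (p368836) / kcells 2736/1000 (staged) · a = 1289/1000: 3080/1000 ≤ 3.144 ≤ kcells 3309/1000 p2, 3221/1000 p4 (staged)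
(two-step tests reach 94–99 % of the floor).  Standard axioms only.
-/

set_option linter.dupNamespace false
set_option autoImplicit false

noncomputable section

open MeasureTheory Set Finset
open scoped Real BigOperators ArithmeticFunction.vonMangoldt

namespace Summit.RiemannHypothesis.RiemannHypothesis.Theorems.WeilFormatC

namespace FloorLower

/-! ### Step test functions: autocorrelation = overlap lengths -/

/-- Shifting the argument of an interval indicator shifts the interval. -/
theorem indicator_Icc_sub {α β u : ℝ} (x : ℝ) :
    (Icc α β).indicator (1 : ℝ → ℝ) (x - u) = (Icc (α + u) (β + u)).indicator 1 x := by
  by_cases h : x - u ∈ Icc α β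
  · have h' : x ∈ Icc (α + u) (β + u) := ⟨by linarith [h.1], by linarith [h.2]⟩
    rw [Set.indicator_of_mem h, Set.indicator_of_mem h']
    rfl
  · have h' : x ∉ Icc (α + u) (β + u) := fun h' ↦ h ⟨by linarith [h'.1], by linarith [h'.2]⟩
    rw [Set.indicator_of_notMem h, Set.indicator_of_notMem h']

/-- A product of two interval indicators is the indicator of the intersection. -/
theorem indicator_Icc_mul_indicator_Icc (α β γ δ : ℝ) :
    (fun x ↦ (Icc α β).indicator (1 : ℝ → ℝ) x * (Icc γ δ).indicator 1 x) = (Icc α β ∩ Icc γ δ).indicator 1 := by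
  ext x; rw [inter_indicator_one]; rfl

/-- The integral of a product of two interval indicators is the overlap length. -/
theorem integral_indicator_Icc_mul (α β γ δ : ℝ) :
    ∫ x, (Icc α β).indicator (1 : ℝ → ℝ) x * (Icc γ δ).indicator 1 x = max (min β δ - max α γ) 0 := by
  rw [indicator_Icc_mul_indicator_Icc, integral_indicator_one (measurableSet_Icc.inter measurableSet_Icc),
    Icc_inter_Icc, Real.volume_real_Icc]

/-- Integrability of a product of two interval indicators. -/
theorem integrable_indicator_Icc_mul (α β γ δ : ℝ) :
    Integrable (fun x ↦ (Icc α β).indicator (1 : ℝ → ℝ) x * (Icc γ δ).indicator 1 x) := by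
  rw [indicator_Icc_mul_indicator_Icc, integrable_indicator_iff (measurableSet_Icc.inter measurableSet_Icc)]
  exact integrableOn_const (lt_of_le_of_lt (measure_mono inter_subset_right) measure_Icc_lt_top).ne

/-- **Autocorrelation of a step function** `f = Σᵢ cᵢ·1_[αᵢ, βᵢ]`: `∫ f(x − u) f(x) dx = Σᵢⱼ cᵢ cⱼ · |([αᵢ, βᵢ] + u) ∩ [αⱼ, βⱼ]|`. -/
theorem integral_stepTest_shift_mul {k : ℕ} (α β c : Fin k → ℝ) (u : ℝ) :
    ∫ x, (∑ i, c i * (Icc (α i) (β i)).indicator 1 (x - u)) * (∑ j, c j * (Icc (α j) (β j)).indicator 1 x)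
      = ∑ i, ∑ j, c i * c j * max (min (β i + u) (β j) - max (α i + u) (α j)) 0 := by
  simp_rw [indicator_Icc_sub, Finset.sum_mul_sum]
  have hterm : ∀ i j, (fun x ↦ c i * (Icc (α i + u) (β i + u)).indicator (1 : ℝ → ℝ) x *
      (c j * (Icc (α j) (β j)).indicator 1 x))
      = fun x ↦ (c i * c j) * ((Icc (α i + u) (β i + u)).indicator (1 : ℝ → ℝ) x *
          (Icc (α j) (β j)).indicator 1 x) := by
    intro i j; ext x; ring
  have hint : ∀ i j, Integrable (fun x ↦ c i * (Icc (α i + u) (β i + u)).indicator (1 : ℝ → ℝ) x *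
      (c j * (Icc (α j) (β j)).indicator 1 x)) := by
    intro i j; rw [hterm]; exact (integrable_indicator_Icc_mul _ _ _ _).const_mul _
  rw [integral_finsetSum _ fun i _ ↦ integrable_finsetSum _ fun j _ ↦ hint i j]
  refine Finset.sum_congr rfl fun i _ ↦ ?_
  rw [integral_finsetSum _ fun j _ ↦ hint i j]
  refine Finset.sum_congr rfl fun j _ ↦ ?_
  rw [hterm, integral_const_mul, integral_indicator_Icc_mul]

/-- **Testing a uniform shift bound on a step function.**  If `Σ_{m ∈ T} w_m ∫ f(x − u_m) f(x) dx ≤ A ∫ f²` for every real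
measurable bounded `f` vanishing off `[−a, a]`, then for heights `cᵢ` on intervals `[αᵢ, βᵢ] ⊆ [−a, a]`,
`Σ_m w_m Ψ(u_m, u_m) ≤ A · Ψ(0, 0)` with the overlap form `Ψ(s, t) = Σᵢⱼ cᵢcⱼ · max (min (βᵢ+s) βⱼ − max (αᵢ+t) αⱼ) 0`
(written as a lambda so that instances can name it). -/
theorem shiftBound_stepTest {a A : ℝ} {ι : Type*} (T : Finset ι) (w u : ι → ℝ) {k : ℕ} (α β c : Fin k → ℝ)
    (hin : ∀ i, -a ≤ α i ∧ β i ≤ a)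
    (hJ : ∀ (f : ℝ → ℝ) (C : ℝ), Measurable f → (∀ x, |f x| ≤ C) → (∀ x, x ∉ Icc (-a) a → f x = 0) →
      ∑ m ∈ T, w m * (∫ x, f (x - u m) * f x) ≤ A * ∫ x, f x ^ 2) :
    ∑ m ∈ T, w m * (fun s t : ℝ ↦ ∑ i, ∑ j, c i * c j * max (min (β i + s) (β j) - max (α i + t) (α j)) 0) (u m) (u m)
      ≤ A * (fun s t : ℝ ↦ ∑ i, ∑ j, c i * c j * max (min (β i + s) (β j) - max (α i + t) (α j)) 0) 0 0 := by
  show ∑ m ∈ T, w m * (∑ i, ∑ j, c i * c j * max (min (β i + u m) (β j) - max (α i + u m) (α j)) 0)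
      ≤ A * ∑ i, ∑ j, c i * c j * max (min (β i + 0) (β j) - max (α i + 0) (α j)) 0
  set f : ℝ → ℝ := fun x ↦ ∑ i, c i * (Icc (α i) (β i)).indicator 1 x with hf
  have hmeas : Measurable f :=
    Finset.measurable_sum _ fun i _ ↦ (measurable_one.indicator measurableSet_Icc).const_mul _
  have hbd : ∀ x, |f x| ≤ ∑ i, |c i| := by
    intro x
    refine (Finset.abs_sum_le_sum_abs _ _).trans (Finset.sum_le_sum fun i _ ↦ ?_)
    have h1 : |(Icc (α i) (β i)).indicator (1 : ℝ → ℝ) x| ≤ 1 := by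
      simp only [Set.indicator_apply, Pi.one_apply]; split_ifs <;> simp
    rw [abs_mul]
    calc |c i| * |(Icc (α i) (β i)).indicator (1 : ℝ → ℝ) x| ≤ |c i| * 1 :=
          mul_le_mul_of_nonneg_left h1 (abs_nonneg _)
      _ = |c i| := mul_one _
  have hsupp : ∀ x, x ∉ Icc (-a) a → f x = 0 := by
    intro x hx
    refine Finset.sum_eq_zero fun i _ ↦ ?_
    rw [Set.indicator_of_notMem, mul_zero]
    exact fun hxi ↦ hx ⟨by linarith [(hin i).1, hxi.1], by linarith [(hin i).2, hxi.2]⟩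
  have h := hJ f _ hmeas hbd hsupp
  have hI : ∀ v, ∫ x, f (x - v) * f x = ∑ i, ∑ j, c i * c j * max (min (β i + v) (β j) - max (α i + v) (α j)) 0 :=
    fun v ↦ integral_stepTest_shift_mul α β c v
  have h0 : ∫ x, f x ^ 2 = ∑ i, ∑ j, c i * c j * max (min (β i + 0) (β j) - max (α i + 0) (α j)) 0 := by
    rw [← hI 0]
    exact integral_congr_ae (Filter.Eventually.of_forall fun x ↦ by simp only [sub_zero, pow_two])
  simp_rw [hI] at h
  rwa [h0] at h

/-- **Monotone evaluation** of one weighted overlap form inside brackets: for nonnegative heights, `lo ≤ u ≤ hi`,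
`0 ≤ wlo ≤ w` and a value `v` below the form with `lo` in the minima and `hi` in the maxima, `wlo·v` is a lower bound. -/
theorem stepOverlap_mono {k : ℕ} (α β c : Fin k → ℝ) (hc : ∀ i, 0 ≤ c i) {u lo hi w wlo v : ℝ}
    (hlo : lo ≤ u) (hhi : u ≤ hi) (hw : wlo ≤ w) (hwlo : 0 ≤ wlo)
    (hv : v ≤ (fun s t : ℝ ↦ ∑ i, ∑ j, c i * c j * max (min (β i + s) (β j) - max (α i + t) (α j)) 0) lo hi) :
    wlo * v ≤ w * (fun s t : ℝ ↦ ∑ i, ∑ j, c i * c j * max (min (β i + s) (β j) - max (α i + t) (α j)) 0) u u := by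
  change v ≤ ∑ i, ∑ j, c i * c j * max (min (β i + lo) (β j) - max (α i + hi) (α j)) 0 at hv
  show wlo * v ≤ w * ∑ i, ∑ j, c i * c j * max (min (β i + u) (β j) - max (α i + u) (α j)) 0
  have hS : ∑ i, ∑ j, c i * c j * max (min (β i + lo) (β j) - max (α i + hi) (α j)) 0
      ≤ ∑ i, ∑ j, c i * c j * max (min (β i + u) (β j) - max (α i + u) (α j)) 0 := by
    refine Finset.sum_le_sum fun i _ ↦ Finset.sum_le_sum fun j _ ↦ ?_
    refine mul_le_mul_of_nonneg_left (max_le_max ?_ le_rfl) (mul_nonneg (hc i) (hc j))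
    exact sub_le_sub (min_le_min (by linarith) le_rfl) (max_le_max (by linarith) le_rfl)
  have hS0 : 0 ≤ ∑ i, ∑ j, c i * c j * max (min (β i + u) (β j) - max (α i + u) (α j)) 0 :=
    Finset.sum_nonneg fun i _ ↦ Finset.sum_nonneg fun j _ ↦
      mul_nonneg (mul_nonneg (hc i) (hc j)) (le_max_right _ _)
  nlinarith [mul_le_mul_of_nonneg_left (hv.trans hS) hwlo, mul_le_mul_of_nonneg_right hw hS0]

/-- Lower bound of a weight `2·log p/√n` from a lower logarithm bracket and an upper root bracket. -/
theorem weight_lower {p n lo r : ℝ} (hlo : lo ≤ Real.log p) (hlo0 : 0 ≤ lo) (hn : 0 < n) (hr : Real.sqrt n ≤ r) :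
    2 * lo / r ≤ 2 * (Real.log p / Real.sqrt n) := by
  rw [mul_div_assoc]
  exact mul_le_mul_of_nonneg_left (div_le_div₀ (hlo0.trans hlo) hlo (Real.sqrt_pos.2 hn) hr) (by norm_num)

/-! ### Certified brackets: logarithms (tree fixed-point logarithm, `decide +kernel`) and square roots -/

/-- **A two-sided logarithm bracket from the fixed-point logarithm**: kernel-decided inequalities on
`FixedPoint.logNatLo/Hi 40 16 e m` give `LOn/LOd ≤ log m ≤ HIn/HId`. -/
theorem log_bracket {m e LOn LOd HIn HId : ℕ} (hm : 2 ^ e ≤ m) (hm' : m ≤ 2 ^ (e + 1)) (hLOd : 0 < LOd)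
    (hHId : 0 < HId) (hlo : LOn * 2 ^ 40 ≤ LOd * Literature.Computability.AlgebraicComplexity.FixedPoint.logNatLo 40 16 e m)
    (hhi : HId * Literature.Computability.AlgebraicComplexity.FixedPoint.logNatHi 40 16 e m ≤ HIn * 2 ^ 40) :
    (LOn : ℝ) / LOd ≤ Real.log m ∧ Real.log m ≤ (HIn : ℝ) / HId := by
  have hs := Literature.Computability.AlgebraicComplexity.FixedPoint.logNatLo_sound 40 16 hm hm'
  have hs2 := Literature.Computability.AlgebraicComplexity.FixedPoint.logNatHi_sound 40 16 hm hm'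
  have hlo' : (LOn : ℝ) * 2 ^ 40 ≤ LOd * (Literature.Computability.AlgebraicComplexity.FixedPoint.logNatLo 40 16 e m : ℝ) := by exact_mod_cast hlo
  have hhi' : (HId : ℝ) * (Literature.Computability.AlgebraicComplexity.FixedPoint.logNatHi 40 16 e m : ℝ) ≤ HIn * 2 ^ 40 := by exact_mod_cast hhi
  have hLOd' : (0 : ℝ) < LOd := by exact_mod_cast hLOd
  have hHId' : (0 : ℝ) < HId := by exact_mod_cast hHId
  have h1 := mul_le_mul_of_nonneg_left hs hLOd'.le
  have h2 := mul_le_mul_of_nonneg_left hs2 hHId'.le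
  have h40 : (0 : ℝ) < 2 ^ 40 := by positivity
  constructor
  · rw [div_le_iff₀ hLOd']
    nlinarith
  · rw [le_div_iff₀ hHId']
    nlinarith
/-- `0.693147179 ≤ log 2 ≤ 0.693147182` and `√2 ≤ 1.414214` (certified). -/
theorem br_2 : (693147179 / 1000000000 : ℝ) ≤ Real.log 2 ∧ Real.log 2 ≤ (346573591 / 500000000 : ℝ) ∧ Real.sqrt 2 ≤ (707107 / 500000 : ℝ) := by
  have h := log_bracket (m := 2) (e := 1) (LOn := 693147179) (LOd := 1000000000) (HIn := 346573591)
    (HId := 500000000) (by norm_num) (by norm_num) (by norm_num) (by norm_num) (by decide +kernel) (by decide +kernel)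
  push_cast at h
  exact ⟨h.1, h.2, Real.sqrt_le_iff.2 ⟨by norm_num, by norm_num⟩⟩
/-- `1.098612287 ≤ log 3 ≤ 1.098612290` and `√3 ≤ 1.732051` (certified). -/
theorem br_3 : (1098612287 / 1000000000 : ℝ) ≤ Real.log 3 ∧ Real.log 3 ≤ (109861229 / 100000000 : ℝ) ∧ Real.sqrt 3 ≤ (1732051 / 1000000 : ℝ) := by
  have h := log_bracket (m := 3) (e := 1) (LOn := 1098612287) (LOd := 1000000000) (HIn := 109861229)
    (HId := 100000000) (by norm_num) (by norm_num) (by norm_num) (by norm_num) (by decide +kernel) (by decide +kernel)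
  push_cast at h
  exact ⟨h.1, h.2, Real.sqrt_le_iff.2 ⟨by norm_num, by norm_num⟩⟩
/-- `1.386294360 ≤ log 4 ≤ 1.386294363` and `√4 ≤ 2.0` (certified). -/
theorem br_4 : (34657359 / 25000000 : ℝ) ≤ Real.log 4 ∧ Real.log 4 ≤ (1386294363 / 1000000000 : ℝ) ∧ Real.sqrt 4 ≤ (2 : ℝ) := by
  have h := log_bracket (m := 4) (e := 2) (LOn := 34657359) (LOd := 25000000) (HIn := 1386294363)
    (HId := 1000000000) (by norm_num) (by norm_num) (by norm_num) (by norm_num) (by decide +kernel) (by decide +kernel)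
  push_cast at h
  exact ⟨h.1, h.2, Real.sqrt_le_iff.2 ⟨by norm_num, by norm_num⟩⟩
/-- `1.609437911 ≤ log 5 ≤ 1.609437914` and `√5 ≤ 2.236068` (certified). -/
theorem br_5 : (1609437911 / 1000000000 : ℝ) ≤ Real.log 5 ∧ Real.log 5 ≤ (804718957 / 500000000 : ℝ) ∧ Real.sqrt 5 ≤ (559017 / 250000 : ℝ) := by
  have h := log_bracket (m := 5) (e := 2) (LOn := 1609437911) (LOd := 1000000000) (HIn := 804718957)
    (HId := 500000000) (by norm_num) (by norm_num) (by norm_num) (by norm_num) (by decide +kernel) (by decide +kernel)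
  push_cast at h
  exact ⟨h.1, h.2, Real.sqrt_le_iff.2 ⟨by norm_num, by norm_num⟩⟩
/-- `1.945910148 ≤ log 7 ≤ 1.945910151` and `√7 ≤ 2.645752` (certified). -/
theorem br_7 : (486477537 / 250000000 : ℝ) ≤ Real.log 7 ∧ Real.log 7 ≤ (1945910151 / 1000000000 : ℝ) ∧ Real.sqrt 7 ≤ (330719 / 125000 : ℝ) := by
  have h := log_bracket (m := 7) (e := 2) (LOn := 486477537) (LOd := 250000000) (HIn := 1945910151)
    (HId := 1000000000) (by norm_num) (by norm_num) (by norm_num) (by norm_num) (by decide +kernel) (by decide +kernel)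
  push_cast at h
  exact ⟨h.1, h.2, Real.sqrt_le_iff.2 ⟨by norm_num, by norm_num⟩⟩
/-- `2.079441540 ≤ log 8 ≤ 2.079441543` and `√8 ≤ 2.828428` (certified). -/
theorem br_8 : (103972077 / 50000000 : ℝ) ≤ Real.log 8 ∧ Real.log 8 ≤ (2079441543 / 1000000000 : ℝ) ∧ Real.sqrt 8 ≤ (707107 / 250000 : ℝ) := by
  have h := log_bracket (m := 8) (e := 3) (LOn := 103972077) (LOd := 50000000) (HIn := 2079441543)
    (HId := 1000000000) (by norm_num) (by norm_num) (by norm_num) (by norm_num) (by decide +kernel) (by decide +kernel)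
  push_cast at h
  exact ⟨h.1, h.2, Real.sqrt_le_iff.2 ⟨by norm_num, by norm_num⟩⟩
/-- `2.197224576 ≤ log 9 ≤ 2.197224579` and `√9 ≤ 3.0` (certified). -/
theorem br_9 : (17165817 / 7812500 : ℝ) ≤ Real.log 9 ∧ Real.log 9 ≤ (2197224579 / 1000000000 : ℝ) ∧ Real.sqrt 9 ≤ (3 : ℝ) := by
  have h := log_bracket (m := 9) (e := 3) (LOn := 17165817) (LOd := 7812500) (HIn := 2197224579)
    (HId := 1000000000) (by norm_num) (by norm_num) (by norm_num) (by norm_num) (by decide +kernel) (by decide +kernel)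
  push_cast at h
  exact ⟨h.1, h.2, Real.sqrt_le_iff.2 ⟨by norm_num, by norm_num⟩⟩
/-- `2.397895271 ≤ log 11 ≤ 2.397895274` and `√11 ≤ 3.316625` (certified). -/
theorem br_11 : (2397895271 / 1000000000 : ℝ) ≤ Real.log 11 ∧ Real.log 11 ≤ (1198947637 / 500000000 : ℝ) ∧ Real.sqrt 11 ≤ (26533 / 8000 : ℝ) := by
  have h := log_bracket (m := 11) (e := 3) (LOn := 2397895271) (LOd := 1000000000) (HIn := 1198947637)
    (HId := 500000000) (by norm_num) (by norm_num) (by norm_num) (by norm_num) (by decide +kernel) (by decide +kernel)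
  push_cast at h
  exact ⟨h.1, h.2, Real.sqrt_le_iff.2 ⟨by norm_num, by norm_num⟩⟩
/-- `2.564949356 ≤ log 13 ≤ 2.564949359` and `√13 ≤ 3.605552` (certified). -/
theorem br_13 : (641237339 / 250000000 : ℝ) ≤ Real.log 13 ∧ Real.log 13 ≤ (2564949359 / 1000000000 : ℝ) ∧ Real.sqrt 13 ≤ (225347 / 62500 : ℝ) := by
  have h := log_bracket (m := 13) (e := 3) (LOn := 641237339) (LOd := 250000000) (HIn := 2564949359)
    (HId := 1000000000) (by norm_num) (by norm_num) (by norm_num) (by norm_num) (by decide +kernel) (by decide +kernel)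
  push_cast at h
  exact ⟨h.1, h.2, Real.sqrt_le_iff.2 ⟨by norm_num, by norm_num⟩⟩
/-! ### von Mangoldt values -/
/-- `Λ 0 = 0`. -/
theorem vm_0 : Λ 0 = 0 := by simp
/-- `Λ 1 = 0`. -/
theorem vm_1 : Λ 1 = 0 := ArithmeticFunction.vonMangoldt_apply_one
/-- `Λ 2 = log 2`. -/
theorem vm_2 : Λ 2 = Real.log 2 := ArithmeticFunction.vonMangoldt_apply_prime (by norm_num)
/-- `Λ 3 = log 3`. -/
theorem vm_3 : Λ 3 = Real.log 3 := ArithmeticFunction.vonMangoldt_apply_prime (by norm_num)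
/-- `Λ 4 = log 2` (`4 = 2^2`). -/
theorem vm_4 : Λ 4 = Real.log 2 := by
  rw [show (4 : ℕ) = 2 ^ 2 by norm_num, ArithmeticFunction.vonMangoldt_apply_pow (by norm_num)]
  exact ArithmeticFunction.vonMangoldt_apply_prime (by norm_num)
/-- `Λ 5 = log 5`. -/
theorem vm_5 : Λ 5 = Real.log 5 := ArithmeticFunction.vonMangoldt_apply_prime (by norm_num)
/-- `Λ 6 = 0` (not a prime power). -/
theorem vm_6 : Λ 6 = 0 := ArithmeticFunction.vonMangoldt_eq_zero_iff.2 (by decide)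
/-- `Λ 7 = log 7`. -/
theorem vm_7 : Λ 7 = Real.log 7 := ArithmeticFunction.vonMangoldt_apply_prime (by norm_num)
/-- `Λ 8 = log 2` (`8 = 2^3`). -/
theorem vm_8 : Λ 8 = Real.log 2 := by
  rw [show (8 : ℕ) = 2 ^ 3 by norm_num, ArithmeticFunction.vonMangoldt_apply_pow (by norm_num)]
  exact ArithmeticFunction.vonMangoldt_apply_prime (by norm_num)
/-- `Λ 9 = log 3` (`9 = 3^2`). -/
theorem vm_9 : Λ 9 = Real.log 3 := by
  rw [show (9 : ℕ) = 3 ^ 2 by norm_num, ArithmeticFunction.vonMangoldt_apply_pow (by norm_num)]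
  exact ArithmeticFunction.vonMangoldt_apply_prime (by norm_num)
/-- `Λ 10 = 0` (not a prime power). -/
theorem vm_10 : Λ 10 = 0 := ArithmeticFunction.vonMangoldt_eq_zero_iff.2 (by decide)
/-- `Λ 11 = log 11`. -/
theorem vm_11 : Λ 11 = Real.log 11 := ArithmeticFunction.vonMangoldt_apply_prime (by norm_num)
/-- `Λ 12 = 0` (not a prime power). -/
theorem vm_12 : Λ 12 = 0 := ArithmeticFunction.vonMangoldt_eq_zero_iff.2 (by decide)
/-- `Λ 13 = log 13`. -/
theorem vm_13 : Λ 13 = Real.log 13 := ArithmeticFunction.vonMangoldt_apply_prime (by norm_num)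
/-! ### The windows: two-step even test functions -/
/-- **Far-constant floor from below at `a = 1`** (`e^(2a) ≤ 8`): every uniform shift bound `A` of the
window `[−1, 1]` in the range-`8` form satisfies `1838/1000 ≤ A` (two-step test: edge bands of width `39/100`,
height `3/2`; certified value `1.83829`; upper side: `primeCoeff_form_ge_cells_one_v2` 2027/1000 (p334036)). -/
theorem le_of_shiftBound_range8_one {A : ℝ}
    (hJ : ∀ (f : ℝ → ℝ) (C : ℝ), Measurable f → (∀ x, |f x| ≤ C) →
      (∀ x, x ∉ Icc (-(1 : ℝ)) (1 : ℝ) → f x = 0) →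
      ∑ n ∈ Finset.range 8, 2 * ((Λ n : ℝ) / Real.sqrt n) * (∫ x, f (x - Real.log n) * f x) ≤ A * ∫ x, f x ^ 2) :
    (1838 / 1000 : ℝ) ≤ A := by
  set α := (![-1, -(61 / 100), 61 / 100] : Fin 3 → ℝ) with hα
  set β := (![-(61 / 100), 61 / 100, 1] : Fin 3 → ℝ) with hβ
  set c := (![3 / 2, 1, 3 / 2] : Fin 3 → ℝ) with hc
  have hc0 : ∀ i, 0 ≤ c i := by intro i; fin_cases i <;> norm_num [hc]
  have h := shiftBound_stepTest (Finset.range 8) (fun n : ℕ ↦ 2 * ((Λ n : ℝ) / Real.sqrt n))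
    (fun n : ℕ ↦ Real.log n) α β c (by intro i; fin_cases i <;> norm_num [hα, hβ]) hJ
  have t2 := stepOverlap_mono α β c hc0 (u := Real.log 2) (v := 3393705627 / 2000000000) br_2.1 br_2.2.1
    (weight_lower br_2.1 (by norm_num) (by norm_num) br_2.2.2) (by norm_num)
    (by simp only [hα, hβ, hc, Fin.sum_univ_succ, Fin.sum_univ_zero, Matrix.cons_val_zero, Matrix.cons_val_succ]; norm_num [max_def, min_def])
  have t3 := stepOverlap_mono α β c hc0 (u := Real.log 3) (v := 2582775411 / 2000000000) br_3.1 br_3.2.1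
    (weight_lower br_3.1 (by norm_num) (by norm_num) br_3.2.2) (by norm_num)
    (by simp only [hα, hβ, hc, Fin.sum_univ_succ, Fin.sum_univ_zero, Matrix.cons_val_zero, Matrix.cons_val_succ]; norm_num [max_def, min_def])
  have t4 := stepOverlap_mono α β c hc0 (u := Real.log 4) (v := 1045279221 / 1000000000) br_4.1 br_4.2.1
    (weight_lower br_2.1 (by norm_num) (by norm_num) br_4.2.2) (by norm_num)
    (by simp only [hα, hβ, hc, Fin.sum_univ_succ, Fin.sum_univ_zero, Matrix.cons_val_zero, Matrix.cons_val_succ]; norm_num [max_def, min_def])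
  have t5 := stepOverlap_mono α β c hc0 (u := Real.log 5) (v := 3511686231 / 4000000000) br_5.1 br_5.2.1
    (weight_lower br_5.1 (by norm_num) (by norm_num) br_5.2.2) (by norm_num)
    (by simp only [hα, hβ, hc, Fin.sum_univ_succ, Fin.sum_univ_zero, Matrix.cons_val_zero, Matrix.cons_val_succ]; norm_num [max_def, min_def])
  have t7 := stepOverlap_mono α β c hc0 (u := Real.log 7) (v := 486808641 / 4000000000) br_7.1 br_7.2.1
    (weight_lower br_7.1 (by norm_num) (by norm_num) br_7.2.2) (by norm_num)
    (by simp only [hα, hβ, hc, Fin.sum_univ_succ, Fin.sum_univ_zero, Matrix.cons_val_zero, Matrix.cons_val_succ]; norm_num [max_def, min_def])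
  set Ψ := (fun s t : ℝ ↦ ∑ i, ∑ j, c i * c j * max (min (β i + s) (β j) - max (α i + t) (α j)) 0) with hΨ
  simp only [Finset.sum_range_succ, Finset.sum_range_zero, vm_0, vm_1, vm_2, vm_3, vm_4, vm_5, vm_6, vm_7,
    Nat.cast_ofNat, Nat.cast_one, Nat.cast_zero, zero_div, mul_zero, zero_mul, zero_add, add_zero] at h
  have e0 : Ψ 0 0 = (119 / 40 : ℝ) := by
    simp only [hΨ, hα, hβ, hc, Fin.sum_univ_succ, Fin.sum_univ_zero, Matrix.cons_val_zero, Matrix.cons_val_succ]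
    norm_num [max_def, min_def]
  rw [e0] at h
  linarith [t2, t3, t4, t5, t7]
/-- **Far-constant floor from below at `a = 1198/1000`** (`e^(2a) ≤ 11`): every uniform shift bound `A` of the
window `[−1198/1000, 1198/1000]` in the range-`11` form satisfies `2649/1000 ≤ A` (two-step test: edge bands of width `9/20`,
height `7/5`; certified value `2.64958`; upper side: `primeCoeff_form_ge_cells_1198` 2773/1000 (p368836) / kcells 2736/1000 (staged)). -/
theorem le_of_shiftBound_range11_1198 {A : ℝ}
    (hJ : ∀ (f : ℝ → ℝ) (C : ℝ), Measurable f → (∀ x, |f x| ≤ C) →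
      (∀ x, x ∉ Icc (-(1198 / 1000 : ℝ)) (1198 / 1000 : ℝ) → f x = 0) →
      ∑ n ∈ Finset.range 11, 2 * ((Λ n : ℝ) / Real.sqrt n) * (∫ x, f (x - Real.log n) * f x) ≤ A * ∫ x, f x ^ 2) :
    (2649 / 1000 : ℝ) ≤ A := by
  set α := (![-(599 / 500), -(187 / 250), 187 / 250] : Fin 3 → ℝ) with hα
  set β := (![-(187 / 250), 187 / 250, 599 / 500] : Fin 3 → ℝ) with hβ
  set c := (![7 / 5, 1, 7 / 5] : Fin 3 → ℝ) with hc
  have hc0 : ∀ i, 0 ≤ c i := by intro i; fin_cases i <;> norm_num [hc]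
  have h := shiftBound_stepTest (Finset.range 11) (fun n : ℕ ↦ 2 * ((Λ n : ℝ) / Real.sqrt n))
    (fun n : ℕ ↦ Real.log n) α β c (by intro i; fin_cases i <;> norm_num [hα, hβ]) hJ
  have t2 := stepOverlap_mono α β c hc0 (u := Real.log 2) (v := 10314264069 / 5000000000) br_2.1 br_2.2.1
    (weight_lower br_2.1 (by norm_num) (by norm_num) br_2.2.2) (by norm_num)
    (by simp only [hα, hβ, hc, Fin.sum_univ_succ, Fin.sum_univ_zero, Matrix.cons_val_zero, Matrix.cons_val_succ]; norm_num [max_def, min_def])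
  have t3 := stepOverlap_mono α β c hc0 (u := Real.log 3) (v := 8286938529 / 5000000000) br_3.1 br_3.2.1
    (weight_lower br_3.1 (by norm_num) (by norm_num) br_3.2.2) (by norm_num)
    (by simp only [hα, hβ, hc, Fin.sum_univ_succ, Fin.sum_univ_zero, Matrix.cons_val_zero, Matrix.cons_val_succ]; norm_num [max_def, min_def])
  have t4 := stepOverlap_mono α β c hc0 (u := Real.log 4) (v := 1712132041 / 1250000000) br_4.1 br_4.2.1
    (weight_lower br_2.1 (by norm_num) (by norm_num) br_4.2.2) (by norm_num)
    (by simp only [hα, hβ, hc, Fin.sum_univ_succ, Fin.sum_univ_zero, Matrix.cons_val_zero, Matrix.cons_val_succ]; norm_num [max_def, min_def])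
  have t5 := stepOverlap_mono α β c hc0 (u := Real.log 5) (v := 29117803659 / 25000000000) br_5.1 br_5.2.1
    (weight_lower br_5.1 (by norm_num) (by norm_num) br_5.2.2) (by norm_num)
    (by simp only [hα, hβ, hc, Fin.sum_univ_succ, Fin.sum_univ_zero, Matrix.cons_val_zero, Matrix.cons_val_succ]; norm_num [max_def, min_def])
  have t7 := stepOverlap_mono α β c hc0 (u := Real.log 7) (v := 11025943341 / 12500000000) br_7.1 br_7.2.1
    (weight_lower br_7.1 (by norm_num) (by norm_num) br_7.2.2) (by norm_num)
    (by simp only [hα, hβ, hc, Fin.sum_univ_succ, Fin.sum_univ_zero, Matrix.cons_val_zero, Matrix.cons_val_succ]; norm_num [max_def, min_def])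
  have t8 := stepOverlap_mono α β c hc0 (u := Real.log 8) (v := 15511364393 / 25000000000) br_8.1 br_8.2.1
    (weight_lower br_2.1 (by norm_num) (by norm_num) br_8.2.2) (by norm_num)
    (by simp only [hα, hβ, hc, Fin.sum_univ_succ, Fin.sum_univ_zero, Matrix.cons_val_zero, Matrix.cons_val_succ]; norm_num [max_def, min_def])
  have t9 := stepOverlap_mono α β c hc0 (u := Real.log 9) (v := 9739995629 / 25000000000) br_9.1 br_9.2.1
    (weight_lower br_3.1 (by norm_num) (by norm_num) br_9.2.2) (by norm_num)
    (by simp only [hα, hβ, hc, Fin.sum_univ_succ, Fin.sum_univ_zero, Matrix.cons_val_zero, Matrix.cons_val_succ]; norm_num [max_def, min_def])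
  set Ψ := (fun s t : ℝ ↦ ∑ i, ∑ j, c i * c j * max (min (β i + s) (β j) - max (α i + t) (α j)) 0) with hΨ
  simp only [Finset.sum_range_succ, Finset.sum_range_zero, vm_0, vm_1, vm_2, vm_3, vm_4, vm_5, vm_6, vm_7, vm_8, vm_9, vm_10,
    Nat.cast_ofNat, Nat.cast_one, Nat.cast_zero, zero_div, mul_zero, zero_mul, zero_add, add_zero] at h
  have e0 : Ψ 0 0 = (163 / 50 : ℝ) := by
    simp only [hΨ, hα, hβ, hc, Fin.sum_univ_succ, Fin.sum_univ_zero, Matrix.cons_val_zero, Matrix.cons_val_succ]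
    norm_num [max_def, min_def]
  rw [e0] at h
  linarith [t2, t3, t4, t5, t7, t8, t9]
/-- **Far-constant floor from below at `a = 1289/1000`** (`e^(2a) ≤ 14`): every uniform shift bound `A` of the
window `[−1289/1000, 1289/1000]` in the range-`14` form satisfies `3080/1000 ≤ A` (two-step test: edge bands of width `19/50`,
height `7/5`; certified value `3.08089`; upper side: kcells 3309/1000 p2, 3221/1000 p4 (staged)). -/
theorem le_of_shiftBound_range14_1289 {A : ℝ}
    (hJ : ∀ (f : ℝ → ℝ) (C : ℝ), Measurable f → (∀ x, |f x| ≤ C) →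
      (∀ x, x ∉ Icc (-(1289 / 1000 : ℝ)) (1289 / 1000 : ℝ) → f x = 0) →
      ∑ n ∈ Finset.range 14, 2 * ((Λ n : ℝ) / Real.sqrt n) * (∫ x, f (x - Real.log n) * f x) ≤ A * ∫ x, f x ^ 2) :
    (3080 / 1000 : ℝ) ≤ A := by
  set α := (![-(1289 / 1000), -(909 / 1000), 909 / 1000] : Fin 3 → ℝ) with hα
  set β := (![-(909 / 1000), 909 / 1000, 1289 / 1000] : Fin 3 → ℝ) with hβ
  set c := (![7 / 5, 1, 7 / 5] : Fin 3 → ℝ) with hc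
  have hc0 : ∀ i, 0 ≤ c i := by intro i; fin_cases i <;> norm_num [hc]
  have h := shiftBound_stepTest (Finset.range 14) (fun n : ℕ ↦ 2 * ((Λ n : ℝ) / Real.sqrt n))
    (fun n : ℕ ↦ Real.log n) α β c (by intro i; fin_cases i <;> norm_num [hα, hβ]) hJ
  have t2 := stepOverlap_mono α β c hc0 (u := Real.log 2) (v := 10944264069 / 5000000000) br_2.1 br_2.2.1
    (weight_lower br_2.1 (by norm_num) (by norm_num) br_2.2.2) (by norm_num)
    (by simp only [hα, hβ, hc, Fin.sum_univ_succ, Fin.sum_univ_zero, Matrix.cons_val_zero, Matrix.cons_val_succ]; norm_num [max_def, min_def])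
  have t3 := stepOverlap_mono α β c hc0 (u := Real.log 3) (v := 8916938529 / 5000000000) br_3.1 br_3.2.1
    (weight_lower br_3.1 (by norm_num) (by norm_num) br_3.2.2) (by norm_num)
    (by simp only [hα, hβ, hc, Fin.sum_univ_succ, Fin.sum_univ_zero, Matrix.cons_val_zero, Matrix.cons_val_succ]; norm_num [max_def, min_def])
  have t4 := stepOverlap_mono α β c hc0 (u := Real.log 4) (v := 1869632041 / 1250000000) br_4.1 br_4.2.1
    (weight_lower br_2.1 (by norm_num) (by norm_num) br_4.2.2) (by norm_num)
    (by simp only [hα, hβ, hc, Fin.sum_univ_succ, Fin.sum_univ_zero, Matrix.cons_val_zero, Matrix.cons_val_succ]; norm_num [max_def, min_def])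
  have t5 := stepOverlap_mono α β c hc0 (u := Real.log 5) (v := 6362810409 / 5000000000) br_5.1 br_5.2.1
    (weight_lower br_5.1 (by norm_num) (by norm_num) br_5.2.2) (by norm_num)
    (by simp only [hα, hβ, hc, Fin.sum_univ_succ, Fin.sum_univ_zero, Matrix.cons_val_zero, Matrix.cons_val_succ]; norm_num [max_def, min_def])
  have t7 := stepOverlap_mono α β c hc0 (u := Real.log 7) (v := 11956943341 / 12500000000) br_7.1 br_7.2.1
    (weight_lower br_7.1 (by norm_num) (by norm_num) br_7.2.2) (by norm_num)
    (by simp only [hα, hβ, hc, Fin.sum_univ_succ, Fin.sum_univ_zero, Matrix.cons_val_zero, Matrix.cons_val_succ]; norm_num [max_def, min_def])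
  have t8 := stepOverlap_mono α β c hc0 (u := Real.log 8) (v := 422194549 / 500000000) br_8.1 br_8.2.1
    (weight_lower br_2.1 (by norm_num) (by norm_num) br_8.2.2) (by norm_num)
    (by simp only [hα, hβ, hc, Fin.sum_univ_succ, Fin.sum_univ_zero, Matrix.cons_val_zero, Matrix.cons_val_succ]; norm_num [max_def, min_def])
  have t9 := stepOverlap_mono α β c hc0 (u := Real.log 9) (v := 9318141847 / 12500000000) br_9.1 br_9.2.1
    (weight_lower br_3.1 (by norm_num) (by norm_num) br_9.2.2) (by norm_num)
    (by simp only [hα, hβ, hc, Fin.sum_univ_succ, Fin.sum_univ_zero, Matrix.cons_val_zero, Matrix.cons_val_succ]; norm_num [max_def, min_def])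
  have t11 := stepOverlap_mono α β c hc0 (u := Real.log 11) (v := 4412565787 / 12500000000) br_11.1 br_11.2.1
    (weight_lower br_11.1 (by norm_num) (by norm_num) br_11.2.2) (by norm_num)
    (by simp only [hα, hβ, hc, Fin.sum_univ_succ, Fin.sum_univ_zero, Matrix.cons_val_zero, Matrix.cons_val_succ]; norm_num [max_def, min_def])
  have t13 := stepOverlap_mono α β c hc0 (u := Real.log 13) (v := 639481409 / 25000000000) br_13.1 br_13.2.1
    (weight_lower br_13.1 (by norm_num) (by norm_num) br_13.2.2) (by norm_num)
    (by simp only [hα, hβ, hc, Fin.sum_univ_succ, Fin.sum_univ_zero, Matrix.cons_val_zero, Matrix.cons_val_succ]; norm_num [max_def, min_def])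
  set Ψ := (fun s t : ℝ ↦ ∑ i, ∑ j, c i * c j * max (min (β i + s) (β j) - max (α i + t) (α j)) 0) with hΨ
  simp only [Finset.sum_range_succ, Finset.sum_range_zero, vm_0, vm_1, vm_2, vm_3, vm_4, vm_5, vm_6, vm_7, vm_8, vm_9, vm_10, vm_11, vm_12, vm_13,
    Nat.cast_ofNat, Nat.cast_one, Nat.cast_zero, zero_div, mul_zero, zero_mul, zero_add, add_zero] at h
  have e0 : Ψ 0 0 = (8269 / 2500 : ℝ) := by
    simp only [hΨ, hα, hβ, hc, Fin.sum_univ_succ, Fin.sum_univ_zero, Matrix.cons_val_zero, Matrix.cons_val_succ]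
    norm_num [max_def, min_def]
  rw [e0] at h
  linarith [t2, t3, t4, t5, t7, t8, t9, t11, t13]
end FloorLower

end Summit.RiemannHypothesis.RiemannHypothesis.Theorems.WeilFormatC

namespace Summit.RiemannHypothesis.RiemannHypothesis.Theorems.WeilFormatC.FloorLower

/-- `e^{2b} ≤ N` from a certified logarithm lower bound `2b < lo ≤ log N` (window facts; appendix weil-1 gen8). -/
theorem exp_two_mul_le_of_lt_log {b lo : ℝ} {N : ℕ} (hN : 0 < N) (hlo : lo ≤ Real.log N) (hb : 2 * b < lo) :
    Real.exp (2 * b) ≤ (N : ℝ) := by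
  have h := Real.exp_lt_exp.2 (hb.trans_le hlo); rw [Real.exp_log (by exact_mod_cast hN)] at h; exact h.le

end Summit.RiemannHypothesis.RiemannHypothesis.Theorems.WeilFormatC.FloorLower
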